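import Summits.Parity.GeneralizedHardyLittlewood.Theses.PrimeLevelFamEdge
import Literature.NumberTheory.LFunctions.KMVMomentAsymptoticsUniqueness
import Literature.NumberTheory.LFunctions.KMVMollifierDiagonalMainTerm
import Literature.NumberTheory.LFunctions.KMVDiagonalSlack

/-!
# Route `PrimeLevelFamEdge`, crux K_B `BeyondDiagonalBeatsQuarter` (stmt-Parity-20343): the
# FIXED-LEVEL REDUCTION — two-sided control of the mollified second moment just beyond the
# diagonal closes K_B, with NO Petersson input (line `fixed-level-kloosterman`, D-0130 Strategy B)

K_B (rev 3) reads `FirstMomentPrinted → C′`: given Bettin's printed twisted first moment at prime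
level, whatever valid off-diagonal main terms `T₁, T₂` a window `(1, Δ]` beyond the diagonal carries
(`KMV2000.MomentAsymptotics 1 Δ T₁ T₂`), SOME admissible profile beats `¼` on SOME sub-window.

Strategy B (director-frontier 2026-08-27T11:45:43Z, ls-lead WORDS #10) wants the heart inequality
at a FIXED prime level from an analytic estimate of the Kloosterman–Bessel (off-diagonal) part of
the mollified second moment `Q^h(P, 1)` with mollifier `M = q̂^{Δ'}`, `Δ'` just above `1`. This file
is the KERNEL-CHECKED COMPOSITION of that line, with the analytic estimate DISPLAYED AS A
HYPOTHESIS (it is the line's one stub, `stub_offDiagonalControl_X_sq`; OPEN — the second mollified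
moment beyond the diagonal at an individual level is registry famE-02, open in print):

* `abs_T₂_le_of_secondMomentControl` — for any window and any MA-consistent `(T₁, T₂)`: if along
  the good primes (`q̂^{Δ'} ∉ ℕ`) the true second moment stays within
  `2ζ(2)² q̂/(Δ'² log² q̂) · U + O(q̂ log⁻³ q̂)` of the DIAGONAL-SHAPE main term
  `2ζ(2)² q̂/(Δ'² log² q̂) · secondMomentForm Δ' P Q`, then `|T₂ Δ' P Q| ≤ U` (the two displays
  contradict each other for large `log q̂` otherwise — the uniqueness argument of
  `KMV2000.T₂_eq_of_momentAsymptotics`).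
* `beyondDiagonalBeatsQuarter_of_offDiagonalControl_X_sq` — if such a control holds at the profile
  `X²`, `Q = 1`, on an initial segment `(1, b)`, `b ≤ 3/2`, with slack `U(Δ') < 4(Δ'−1)/Δ'`
  (= `2·lin² − second` at `X²`: `lin = 2`, `second = 4 + 4/Δ'`), then K_B holds: Bettin pins
  `T₁ Δ' X² 1 = 0` (`KMV2000.T₁_apply_one_eq_zero_of_bettin`), `|T₂| ≤ U` gives BOTH
  `second + T₂ ≥ 8/Δ' > 0` and `second + T₂ < 8 = 2·lin²`, i.e. value `> ¼` on `(1, min b Δ)`.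

No Petersson formula is used anywhere (R2-G44 hygiene: neither `kowalskiMichel2000_petersson` nor
its repaired form appears; the positivity that the line `birth` takes from the Cauchy–Schwarz floor
comes here from the two-sided control itself). The hypothesis is an unconditional analytic
statement about `KMV2000.QhPQ` — it is what a Petersson–Kloosterman–Bessel analysis at fixed level
would have to deliver, and what bed-4 (D-0130) measures; it is NOT asserted. Standard axioms.
«The programme SEARCHES and TYPES; no claim about Landau–Siegel zeros, Theorems 1–2 of
arXiv:2211.02515 or a repaired Margin232 until a kernel theorem says so.»
-/

namespace Summit.Parity.GeneralizedHardyLittlewood.Theorems.BeyondDiagonalBeatsQuarter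

open Polynomial
open Literature.NumberTheory.LFunctions
open Literature.NumberTheory.LFunctions.KMV2000
open Summit.Parity.GeneralizedHardyLittlewood.Theses.PrimeLevelFamEdge

/-- **Two-sided second-moment control pins `|T₂|`.** If the KMV moment asymptotics hold on a window
with extra main terms `(T₁, T₂)` and, at an admissible `P`, an even-or-odd `Q` and a length
`Δ' ∈ (Δlo, Δhi]`, `Δ' > 0`, with good primes unbounded, the true mollified second moment satisfies
`‖Q^h(P,Q; q̂^{Δ'}) − 2ζ(2)² q̂/(Δ'² log² q̂)·second(Δ',P,Q)‖ ≤ 2ζ(2)² q̂/(Δ'² log² q̂)·U + C q̂ log⁻³ q̂`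
for all large good primes, then `|T₂ Δ' P Q| ≤ U`.
[cite: KowalskiMichelVanderKam2000, §6 p. 19 (shape of the second-moment display), §2 p. 7 (M ∉ ℤ)] -/
theorem abs_T₂_le_of_secondMomentControl {Δlo Δhi : ℝ} {T₁ T₂ : ℝ → ℝ[X] → ℝ[X] → ℝ}
    (hMA : MomentAsymptotics Δlo Δhi T₁ T₂) {P Q : ℝ[X]} (hP : Admissible P)
    (hQ : IsEvenOrOdd Q) {Δ' : ℝ} (h1 : Δlo < Δ') (h2 : Δ' ≤ Δhi) (hΔ' : 0 < Δ')
    (hgood : GoodPrimesUnbounded Δ') {U C : ℝ} {q₁ : ℕ}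
    (hctl : ∀ (q : ℕ) [NeZero q], q.Prime → q₁ ≤ q → (∀ n : ℕ, (n : ℝ) ≠ qhat q ^ Δ') →
      ‖QhPQ q P Q (qhat q ^ Δ') -
          ((2 * riemannZeta 2 ^ 2 * ((qhat q / (Δ' ^ 2 * Real.log (qhat q) ^ 2) : ℝ) : ℂ)) *
            ((secondMomentForm Δ' P Q : ℝ) : ℂ))‖ ≤
        2 * (Real.pi ^ 2 / 6) ^ 2 * (qhat q / (Δ' ^ 2 * Real.log (qhat q) ^ 2)) * U +
          C * qhat q * (Real.log (qhat q))⁻¹ ^ 3) :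
    |T₂ Δ' P Q| ≤ U := by
  by_contra hle
  have hlt : U < |T₂ Δ' P Q| := lt_of_not_ge hle
  obtain ⟨C₂, q₀, H⟩ := hMA P Q hP hQ Δ' h1 h2
  set δ : ℝ := |T₂ Δ' P Q| - U with hδ
  have hδpos : 0 < δ := by rw [hδ]; linarith
  set z : ℝ := 2 * (Real.pi ^ 2 / 6) ^ 2 with hz
  have hzpos : 0 < z := by rw [hz]; positivity
  have hZ : (2 * riemannZeta 2 ^ 2 : ℂ) = ((z : ℝ) : ℂ) := by
    rw [riemannZeta_two, hz]; push_cast; ring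
  set B : ℝ := (|C| + |C₂|) * Δ' ^ 2 / (z * δ) + 1 with hB
  obtain ⟨N, hN⟩ := exists_log_qhat_ge B
  obtain ⟨q, inst, hq, hqge, hgoodq⟩ := hgood (max (max q₀ q₁) N)
  have hq0 : q₀ ≤ q := le_trans (le_trans (le_max_left _ _) (le_max_left _ _)) hqge
  have hq1 : q₁ ≤ q := le_trans (le_trans (le_max_right _ _) (le_max_left _ _)) hqge
  have hqN : N ≤ q := le_trans (le_max_right _ _) hqge
  have hlg : B ≤ Real.log (qhat q) := hN q hqN
  have hB1 : 1 ≤ B := by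
    have : 0 ≤ (|C| + |C₂|) * Δ' ^ 2 / (z * δ) := by positivity
    rw [hB]; linarith
  have hlgpos : 0 < Real.log (qhat q) := by linarith
  have hqhatpos : 0 < qhat q := by
    unfold qhat
    have : 0 < (q : ℝ) := by exact_mod_cast hq.pos
    positivity
  obtain ⟨-, b1⟩ := H q hq hq0 hgoodq
  have b0 := hctl q hq hq1 hgoodq
  set L := QhPQ q P Q (qhat q ^ Δ') with hL
  set r : ℝ := qhat q / (Δ' ^ 2 * Real.log (qhat q) ^ 2) with hr
  have hrpos : 0 < r := by rw [hr]; positivity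
  set A : ℂ := 2 * riemannZeta 2 ^ 2 * ((r : ℝ) : ℂ) *
    ((secondMomentForm Δ' P Q + T₂ Δ' P Q : ℝ) : ℂ) with hA
  set A₀ : ℂ := 2 * riemannZeta 2 ^ 2 * ((r : ℝ) : ℂ) * ((secondMomentForm Δ' P Q : ℝ) : ℂ)
    with hA₀
  have hs3 : 0 ≤ qhat q * (Real.log (qhat q))⁻¹ ^ 3 := by positivity
  have hb1 : ‖L - A‖ ≤ |C₂| * qhat q * (Real.log (qhat q))⁻¹ ^ 3 := by
    refine b1.trans ?_
    rw [mul_assoc, mul_assoc]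
    exact mul_le_mul_of_nonneg_right (le_abs_self C₂) hs3
  have hb0 : ‖L - A₀‖ ≤ z * r * U + |C| * qhat q * (Real.log (qhat q))⁻¹ ^ 3 := by
    refine b0.trans ?_
    have : C * qhat q * (Real.log (qhat q))⁻¹ ^ 3 ≤ |C| * qhat q * (Real.log (qhat q))⁻¹ ^ 3 := by
      rw [mul_assoc, mul_assoc]
      exact mul_le_mul_of_nonneg_right (le_abs_self C) hs3
    linarith
  have hdiff : ‖A - A₀‖ ≤ z * r * U + (|C| + |C₂|) * qhat q * (Real.log (qhat q))⁻¹ ^ 3 := by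
    have e : A - A₀ = (L - A₀) - (L - A) := by ring
    rw [e]
    refine (norm_sub_le _ _).trans ?_
    nlinarith
  have hnormA : ‖A - A₀‖ = z * r * |T₂ Δ' P Q| := by
    have e : A - A₀ = ((z : ℝ) : ℂ) * ((r : ℝ) : ℂ) * ((T₂ Δ' P Q : ℝ) : ℂ) := by
      rw [hA, hA₀, hZ]
      push_cast
      ring
    rw [e, norm_mul, norm_mul, Complex.norm_real, Complex.norm_real, Complex.norm_real,
      Real.norm_eq_abs, Real.norm_eq_abs, Real.norm_eq_abs, abs_of_pos hzpos, abs_of_pos hrpos]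
  have key : z * r * δ ≤ (|C| + |C₂|) * qhat q * (Real.log (qhat q))⁻¹ ^ 3 := by
    have h3 := hnormA ▸ hdiff
    have e : z * r * δ = z * r * |T₂ Δ' P Q| - z * r * U := by rw [hδ]; ring
    rw [e]
    linarith
  -- normalise: `z δ log q̂ ≤ (|C| + |C₂|) Δ'²`
  have key2 : z * δ * Real.log (qhat q) ≤ (|C| + |C₂|) * Δ' ^ 2 := by
    rw [hr] at key
    have hΔ2 : 0 < Δ' ^ 2 := by positivity
    have e1 : z * (qhat q / (Δ' ^ 2 * Real.log (qhat q) ^ 2)) * δ =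
        (z * δ * Real.log (qhat q)) * (qhat q / (Δ' ^ 2 * Real.log (qhat q) ^ 3)) := by
      field_simp
    have e2 : (|C| + |C₂|) * qhat q * (Real.log (qhat q))⁻¹ ^ 3 =
        ((|C| + |C₂|) * Δ' ^ 2) * (qhat q / (Δ' ^ 2 * Real.log (qhat q) ^ 3)) := by
      field_simp
    rw [e1, e2] at key
    have hw : 0 < qhat q / (Δ' ^ 2 * Real.log (qhat q) ^ 3) := by positivity
    exact le_of_mul_le_mul_right key hw
  have hzd : 0 < z * δ := mul_pos hzpos hδpos
  have key3 : z * δ * B ≤ (|C| + |C₂|) * Δ' ^ 2 :=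
    le_trans (mul_le_mul_of_nonneg_left hlg hzd.le) key2
  rw [hB] at key3
  have e3 : z * δ * ((|C| + |C₂|) * Δ' ^ 2 / (z * δ) + 1) = (|C| + |C₂|) * Δ' ^ 2 + z * δ := by
    field_simp
  rw [e3] at key3
  linarith

/-- **Strategy B's composition (Petersson-free): two-sided off-diagonal control at `X²` on an initial
segment closes K_B.** If for some `b ∈ (1, 3/2]` and every length `Δ' ∈ (1, b)` the mollified second
moment `Q^h(X², 1; q̂^{Δ'})` at prime level stays, for all large primes `q` with `q̂^{Δ'} ∉ ℕ`, within
`2ζ(2)² q̂/(Δ'² log² q̂)·U + C q̂ log⁻³ q̂` of its diagonal-shape main term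
`2ζ(2)² q̂/(Δ'² log² q̂)·(4 + 4/Δ')`, with a slack `U < 4(Δ'−1)/Δ' = 2·lin² − second`, then
`BeyondDiagonalBeatsQuarter` holds: the window is `(1, min b Δ)`, the profile `X²`; Bettin's printed
first moment (the crux's antecedent) pins `T₁ = 0`, the control pins `|T₂| ≤ U`, and
`0 < 8/Δ' ≤ 4 + 4/Δ' + T₂ < 8` is value `> ¼`.
[cite: KowalskiMichelVanderKam2000, Thm. 6.1 (30)–(32), §6 p. 19] [cite: Bettin2017, Thm. 1.1] -/
theorem beyondDiagonalBeatsQuarter_of_offDiagonalControl_X_sq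
    (hctl : ∃ b : ℝ, 1 < b ∧ b ≤ 3 / 2 ∧ ∀ Δ' : ℝ, 1 < Δ' → Δ' < b →
      ∃ U C : ℝ, U < 4 * (Δ' - 1) / Δ' ∧ ∃ q₁ : ℕ, ∀ (q : ℕ) [NeZero q], q.Prime → q₁ ≤ q →
        (∀ n : ℕ, (n : ℝ) ≠ qhat q ^ Δ') →
          ‖QhPQ q (X ^ 2) 1 (qhat q ^ Δ') -
              ((2 * riemannZeta 2 ^ 2 * ((qhat q / (Δ' ^ 2 * Real.log (qhat q) ^ 2) : ℝ) : ℂ)) *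
                ((secondMomentForm Δ' (X ^ 2) 1 : ℝ) : ℂ))‖ ≤
            2 * (Real.pi ^ 2 / 6) ^ 2 * (qhat q / (Δ' ^ 2 * Real.log (qhat q) ^ 2)) * U +
              C * qhat q * (Real.log (qhat q))⁻¹ ^ 3) :
    BeyondDiagonalBeatsQuarter := by
  intro hF Δ hΔ T₁ T₂ hMA
  obtain ⟨b, hb1, hb32, hwin⟩ := hctl
  refine ⟨1, min b Δ, le_rfl, lt_min hb1 hΔ, min_le_right _ _, by norm_num, X ^ 2,
    admissible_X_sq, fun Δ' h1' h2' ↦ ?_⟩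
  have hΔ'b : Δ' < b := lt_of_lt_of_le h2' (min_le_left _ _)
  have hΔ'Δ : Δ' < Δ := lt_of_lt_of_le h2' (min_le_right _ _)
  have hΔ'2 : Δ' < 2 := by linarith
  have hΔ'0 : 0 < Δ' := by linarith
  obtain ⟨U, C, hU, q₁, hq⟩ := hwin Δ' h1' hΔ'b
  have hT₂ : |T₂ Δ' (X ^ 2) 1| ≤ U :=
    abs_T₂_le_of_secondMomentControl hMA admissible_X_sq isEvenOrOdd_one h1' hΔ'Δ.le hΔ'0
      (goodPrimesUnbounded_of_lt_two hΔ'0 hΔ'2) (fun q _ hq' hq₁ hg ↦ hq q hq' hq₁ hg)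
  have hT₁ : T₁ Δ' (X ^ 2) 1 = 0 :=
    T₁_apply_one_eq_zero_of_bettin hF admissible_X_sq hMA h1' (lt_min hΔ'Δ hΔ'2)
  rw [hT₁, add_zero, linForm_X_sq_one, secondMomentForm_X_sq_one]
  have hT₂le : T₂ Δ' (X ^ 2) 1 ≤ U := (le_abs_self _).trans hT₂
  have hT₂ge : -U ≤ T₂ Δ' (X ^ 2) 1 := by
    have := neg_abs_le (T₂ Δ' (X ^ 2) 1)
    linarith
  have hslack : 4 * (Δ' - 1) / Δ' = 4 - 4 / Δ' := by field_simp
  rw [hslack] at hU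
  have h4 : 0 < 4 / Δ' := by positivity
  have hDpos : 0 < 4 + 4 / Δ' + T₂ Δ' (X ^ 2) 1 := by linarith
  rw [lt_div_iff₀ (by positivity)]
  nlinarith

end Summit.Parity.GeneralizedHardyLittlewood.Theorems.BeyondDiagonalBeatsQuarter
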